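import Mathlib
import HarnessLib
import Summits.RiemannHypothesis.RiemannHypothesis.Theses.UniversalFactor
import Literature.NumberTheory.LFunctions.DeBruijnHDiv
import Literature.NumberTheory.LFunctions.DeBruijnNewman

/-!
# Sketch — crux-ideate stmt-RiemannHypothesis-2575 (LaplaceLoophole), round 1, ideator 3

First lemmas of the idea card `laplace-newman-curve` (statements only; they must elaborate).
Notation: `Φ = deBruijnPhi`, `H_t = deBruijnH t`, `F_a = deBruijnHDiv (fun u ↦ 1 + u²/a²)`
(the crux's Laplace-smoothed transform), and the two-parameter family
`G_{t,a} = deBruijnHDiv (fun u ↦ exp (-(t u²)) · (1 + u²/a²))` = transform of `e^{tu²} Φ(u)/(1+u²/a²)`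
= Laplace(a)-smoothing of `H_t`.
-/

noncomputable section

open Complex MeasureTheory Set Filter
open Literature.NumberTheory.LFunctions

namespace Summit.RiemannHypothesis.RiemannHypothesis.Cruxes.LaplaceLoophole.Ideator3

/-- The smoothed heat family `G_{t,a}`: de Bruijn's transform of `e^{tu²}Φ(u)/(1+u²/a²)`,
i.e. the Laplace(a)-smoothing of `H_t` (`t = 0`: the crux's `F_a`). -/
def smoothedHeat (t a : ℝ) : ℂ → ℂ :=
  deBruijnHDiv (fun u : ℝ => Real.exp (-(t * u ^ 2)) * (1 + u ^ 2 / a ^ 2))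

/-- `t = 0` slice is the crux's `F_a`, definitionally up to `exp 0 = 1`. -/
theorem smoothedHeat_zero (a : ℝ) :
    smoothedHeat 0 a = deBruijnHDiv (fun u : ℝ => 1 + u ^ 2 / a ^ 2) := by
  funext z
  simp [smoothedHeat]

/-- FIRST LEMMA (Transfer, heat-parameter closure). The crux is equivalent to UNIFORM-in-`t`
real-rootedness of the forward-regularised smoothed family:
`LaplaceLoophole ↔ ∃ a > 0, ∀ t > 0, G_{t,a} ∈ LP`.
(`→`: `e^{tu²}` is a universal factor, `rootsInStrip_zero_gaussian` / `HasOnlyRealZeros.mono`;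
 `←`: Hurwitz as `t ↓ 0`, `G_{t,a} → F_a` locally uniformly, `F_a ≢ 0`.) -/
def TransferClosure : Prop :=
  Summit.RiemannHypothesis.RiemannHypothesis.Theses.UniversalFactor.LaplaceLoophole ↔
    ∃ a : ℝ, 0 < a ∧ ∀ t : ℝ, 0 < t → HasOnlyRealZeros (smoothedHeat t a)

/-- RESOLVENT / SUBORDINATION IDENTITY: `1/(1+u²/a²) = ∫₀^∞ e^{-r} e^{-(r/a²)u²} dr`, hence
`F_a(z) = ∫₀^∞ e^{-r} H_{-r/a²}(z) dr = a²(a² − D²)⁻¹ H_0` — the Laplace-smoothed `Ξ` is the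
exponential-time average (Yosida approximant) of de Bruijn's BACKWARD heat orbit, every point of
which is non-LP (`rodgers_tao`). More generally `G_{t,a}(z) = ∫₀^∞ e^{-r} H_{t − r/a²}(z) dr`. -/
def ResolventIdentity : Prop :=
  ∀ t a : ℝ, 0 < a → ∀ z : ℂ,
    smoothedHeat t a z = ∫ r in Set.Ioi (0 : ℝ), (Real.exp (-r) : ℂ) * deBruijnH (t - r / a ^ 2) z

/-- SMOOTHED KI–KIM–LEE (provable layer, uniform in `a ≥ 1`): for every `t > 0` there is a height
`X` beyond which all zeros of `G_{t,a}` are real, for all `a ≥ 1` at once (the Gaussian weight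
`e^{t u₁²}` of the head term beats the Lorentzian loss `1 + u₁²/a² ≤ 1 + u₁²`). -/
def SmoothedKKL : Prop :=
  ∀ t : ℝ, 0 < t → ∃ X : ℝ, ∀ a : ℝ, 1 ≤ a → ∀ z : ℂ,
    smoothedHeat t a z = 0 → X ≤ |z.re| → z.im = 0

/-- The Laplace–Newman curve tends to `Λ`: above any real-rooted heat time the smoothing is
eventually harmless (`sInf`-free form: Hurwitz on `|Re z| ≤ X` with simple zeros of `H_t` for
`t > t₀ ≥ Λ`, plus `SmoothedKKL`, plus strip confinement). -/
def CurveTendsToLambda : Prop :=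
  ∀ t₀ t : ℝ, t₀ < t → HasOnlyRealZeros (deBruijnH t₀) →
    ∃ a₀ : ℝ, ∀ a : ℝ, a₀ ≤ a → HasOnlyRealZeros (smoothedHeat t a)

/-- Wide kernels are dead at EVERY heat time (`λ(a) = +∞` for generic `a < π/8`): the residue at
`u = ia` gives `G_{t,a}(x) ∼ a C_t(a) e^{-a|x|}` (same proof as the landed `wideKernelNoGo`,
with `e^{tu²}Φ` in place of `Φ`). -/
def WideForAllTimes : Prop :=
  ∀ t a : ℝ, 0 < a → a < Real.pi / 8 →
    (∫ x in Set.Ioi (0 : ℝ), deBruijnH t (x : ℂ) * (Real.cosh (a * x) : ℂ)) ≠ 0 →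
      ¬ HasOnlyRealZeros (smoothedHeat t a)

/-- THE BET (crux-strength, expected FALSE): the Laplace–Newman threshold stays bounded as
`t ↓ 0`. With `TransferClosure` this IS the crux; the heuristic law is `a*(t) ≍ t^{-1/2}`
(equivalently `λ(a) = Λ + (1+o(1))/a²`), which denies it. -/
def BoundedThreshold : Prop :=
  ∃ a : ℝ, 0 < a ∧ ∀ t : ℝ, 0 < t → HasOnlyRealZeros (smoothedHeat t a)

/-- Composition check: the bet and the closure transfer give the crux by name. -/
theorem laplaceLoophole_of (hT : TransferClosure) (hB : BoundedThreshold) :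
    Summit.RiemannHypothesis.RiemannHypothesis.Theses.UniversalFactor.LaplaceLoophole :=
  hT.mpr hB

/-- Sanity: the crux gives the `t = 0` slice of the bet's family (definitional bookkeeping). -/
theorem smoothedHeat_zero_of_laplaceLoophole
    (h : Summit.RiemannHypothesis.RiemannHypothesis.Theses.UniversalFactor.LaplaceLoophole) :
    ∃ a : ℝ, 0 < a ∧ HasOnlyRealZeros (smoothedHeat 0 a) := by
  obtain ⟨a, ha, hF⟩ := h
  refine ⟨a, ha, ?_⟩
  rw [smoothedHeat_zero]
  exact hF

end Summit.RiemannHypothesis.RiemannHypothesis.Cruxes.LaplaceLoophole.Ideator3
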